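import Literature.NumberTheory.Sieve.ClusterComplexity
import HarnessLib

/-!
# The Hardy–Littlewood prime-tuples conjecture on average over the shifts (Balog, Kawada; pairs: Lavrik, Mikawa)

Topic `Literature/NumberTheory/Sieve`, over the Green–Tao dictionary of
`Literature/NumberTheory/Sieve/LinearEquationsInPrimes.lean` (`AffLinForm`, `vonMangoldtSum`,
`archFactor`, `singularProduct`, `realBox`, `GeneralizedHardyLittlewood`) and the shift pair
`Literature.NumberTheory.Sieve.shiftPairSystem` of `ClusterComplexity.lean`.

The binary instances `d = 1`, `t ≥ 2` of the generalised Hardy–Littlewood conjecture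
(`GeneralizedHardyLittlewood`; the prime `k`-tuples conjecture, parity.S01) are open for every
single admissible shift vector, but they are THEOREMS ON AVERAGE over the shift vector — the
constant terms of the forms — by the circle method: "There are a number of results [vdc], [lavrik],
[balog], [wolke], [mikawa], [kawada] that show that (the Hardy–Littlewood prime-pair asymptotic)
holds for 'most' `h` with `|h| ≤ H`, as long as `H` grows moderately quickly with `X`"
(Matomäki–Radziwiłł–Tao 2019, §1.1, p. 4 of arXiv:1707.01315), and for `k`-tuples Balog 1990 and
Kawada 1993: with `Ψ(x; b) = ∑_{n : 1 ≤ n + b_j ≤ x ∀ j} ∏_{j=0}^{k-1} Λ(n + b_j)` (`b₀ = 0`),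
`σ(b) = ∏_p (1 - ρ_b(p)/p)(1 - 1/p)^{-k}` and `|N(x; b)|` the length of the interval
`{n : 1 ≤ n + b_j ≤ x ∀ j}`, Kawada's Theorem 1 (Tsukuba J. Math. 17 (1993), p. 44, inequality (1.1))
gives, for fixed `k ≥ 2`, fixed `a = (a₀, …, a_{k-1}, b₀)` (here `(1, …, 1, 0)`) and `A > 0`,
`∑_{q ≤ Q} max_a ∑_{b ∈ Z(x)} |Ψ(x; b, a, q) - σ(b; a, q)|N(x; b)|| ≪ x^k (log x)^{-A}` for
`Q ≤ x^{1/2}(log x)^{-B}` (Maier–Pomerance 1990: `k = 2`, `Q ≤ x^δ`; Balog 1990: all `k ≥ 2`,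
`Q ≤ x^{1/3}(log x)^{-B}`; Mikawa 1992: `k = 2`, `Q ≤ x^{1/2}(log x)^{-B}` by the dispersion method;
Kawada: all `k`, circle method); its term `q = 1` is the shift average
`∑_{b ∈ Z(x)} |Ψ(x; b) - σ(b)|N(x; b)|| ≪_A x^k (log x)^{-A}` over ALL shift vectors with a non-empty
range (`# Z(x) ≍ x^{k-1}`; `σ(b) := 0` when `R(b) = 0` or some `ρ_b(p) = p`).
Green–Tao 2010, §1 (p. 5 of arXiv:math/0606088):
"it is possible to establish the case `d = 1, t > 1` of the Hardy–Littlewood conjecture on average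
over the choice of forms `ψ₁, …, ψ_t` in a certain sense: see [Balog]. This essentially amounts to
increasing `d`, which can place one back in the 'finite complexity' regime".

This file TYPES the qualitative shift-averaged statements in the Green–Tao dictionary, so that they
are literally consequences of `GeneralizedHardyLittlewood` (PROVED below: the on-path certificates),
and records them as NAMED FACTS (theorems in print, not yet kernel theorems — the kernel proofs are
the work-bound rung F-AVG of the `Parity` ladder, circle method from tree material:
`MatomakiRadziwillTao2019_prop33i_holds`, `primePairMajorArcs_logPow_of_siegelWalfisz`,
`Vinogradov.vinogradov_primeExpSumLog_bound`, Bessel's inequality as in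
`MontgomeryVaughan1975MinorArcs.lean`):

* `tupleShifts b = (0, b₁, …, b_m)`, `tupleShiftSystem b = (n, n + b₁, …, n + b_m)` (`d = 1`,
  `t = m + 1`), `maxShift b = max_j b_j⁺`, `shiftedBox b N = [-(N - maxShift b), N - maxShift b]`
  (the convex body on which every member `n + b_j` is `≤ N`; with `Λ = 0` on `ℤ_{≤ 0}` the
  Green–Tao sum over it is Kawada's `Ψ(N; b)`, its archimedean factor is `|N(N; b)| = N - max_j b_j`
  for `b ∈ [1, N]^m`, and `singularProduct (tupleShiftSystem b) = σ(b)`, `= 0` exactly when `b` is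
  inadmissible);
* `hardyLittlewoodTuples_almostAllShifts` — for every `m ≥ 1` and `ε > 0`, for all large `N`, all
  but at most `ε N^m` of the shift vectors `b ∈ [1, N]^m` with distinct entries satisfy
  `|Ψ(N; b) - σ(b)(N - max b)| ≤ ε N` (qualitative corollary of Kawada's Theorem 1 at `q = 1` /
  Balog 1990, by Markov's inequality);
* `hardyLittlewoodPairs_almostAllShifts` — the case `m = 1` over the tree's `shiftPairSystem h`:
  for all large `N`, all but at most `ε N` shifts `1 ≤ h ≤ N` satisfy
  `|∑_{n ≤ N - h} Λ(n)Λ(n + h) - 𝔖(h)(N - h)| ≤ ε N` (van der Corput 1937 / Lavrik 1960 / Mikawa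
  1991, as reported by Matomäki–Radziwiłł–Tao, loc. cit.);
* PROVED: `isNondegenerateSystem_tupleShiftSystem`, `affLinSize_tupleShiftSystem_le`,
  `shiftPairSystem_eq_tupleShiftSystem`, and the ON-PATH CERTIFICATES
  `hardyLittlewoodTuples_almostAllShifts_of_generalizedHardyLittlewood`,
  `hardyLittlewoodPairs_almostAllShifts_of_generalizedHardyLittlewood`
  (`GeneralizedHardyLittlewood` at `d = 1`, `t = m + 1`, `L = 2(m + 1)` makes the exceptional set
  EMPTY for large `N`, uniformly in `b ∈ [1, N]^m`, because `‖Ψ_b‖_N ≤ 2(m + 1)`).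

Honest label (D-0021): the averaged statements evade the parity / binary-circle-method barriers
(`Literature.Barriers.Parity.CircleMethodBinaryBarrier`, evasion (a) "more variables";
`Literature/Barriers/Parity/TrueComplexityBinary.lean`, Balog's free variable) exactly as
catalogued; they do not move the binary conjecture for any single shift.

## References

* A. Balog, *The prime k-tuplets conjecture on average*, in: Analytic Number Theory (Allerton Park
  1989), Progr. Math. 85, Birkhäuser 1990, 47–75. [Balog1990]
* K. Kawada, *The prime k-tuplets in arithmetic progressions*, Tsukuba J. Math. 17 (1993) 43–57,
  Theorem 1 and (1.1), p. 44. [Kawada1993]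
* H. Mikawa, *On prime twins in arithmetic progressions*, Tsukuba J. Math. 16 (1992) 377–387
  (`k = 2`, level `x^{1/2}(log x)^{-B}`). [Mikawa1992]
* K. Matomäki, M. Radziwiłł, T. Tao, *Correlations of the von Mangoldt and higher divisor functions
  I. Long shift ranges*, Proc. LMS 118 (2019) 284–350, arXiv:1707.01315, §1.1 p. 4 (history:
  van der Corput 1937, Lavrik 1960, Balog 1990, Wolke 1989, Mikawa 1991, Kawada 1993).
  [MatomakiRadziwillTao2019]
* B. Green, T. Tao, *Linear equations in primes*, Ann. of Math. 171 (2010), §1 (remark on [Balog],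
  p. 5 of arXiv:math/0606088) and Example 1. [GreenTao2010]
-/

noncomputable section

open Finset

namespace Literature.NumberTheory.Sieve

variable {m : ℕ}

/-! ### The shifted tuple system `(n, n + b₁, …, n + b_m)` -/

/-- The full shift vector `(0, b₁, …, b_m)` of a tuple `b = (b₁, …, b_m)` (the member `n` itself has
shift `0`; Kawada's `(b₀, b) = (0, b₁, …, b_{k-1})`, `k = m + 1`). [cite: Kawada1993, §1 p. 43] -/
def tupleShifts (b : Fin m → ℤ) : Fin (m + 1) → ℤ :=
  Fin.cons 0 b

/-- `tupleShifts b 0 = 0`. [cite: Kawada1993, §1 p. 43] -/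
@[simp] theorem tupleShifts_zero (b : Fin m → ℤ) : tupleShifts b 0 = 0 :=
  Fin.cons_zero _ _

/-- `tupleShifts b (j+1) = b j`. [cite: Kawada1993, §1 p. 43] -/
@[simp] theorem tupleShifts_succ (b : Fin m → ℤ) (j : Fin m) : tupleShifts b j.succ = b j :=
  Fin.cons_succ _ _ _

/-- The shift vector `(0, b)` has distinct entries iff the `b_j` are distinct and non-zero
(Kawada's `R(b) ≠ 0` for `a = (1, …, 1)`). [cite: Kawada1993, §1 p. 43] -/
theorem tupleShifts_injective_iff (b : Fin m → ℤ) :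
    Function.Injective (tupleShifts b) ↔ (∀ j, b j ≠ 0) ∧ Function.Injective b := by
  rw [tupleShifts, Fin.cons_injective_iff, Set.mem_range, not_exists]

/-- The shifted tuple system `Ψ_b = (n, n + b₁, …, n + b_m)`: `d = 1`, `t = m + 1` forms
`n ↦ n + (tupleShifts b)_i` (Green–Tao, Example 1 is `m = 1`, `b₁ = 2`).
[cite: GreenTao2010, Example 1] [cite: Kawada1993, §1 p. 43] -/
def tupleShiftSystem (b : Fin m → ℤ) : Fin (m + 1) → AffLinForm 1 :=
  fun i => ⟨![1], tupleShifts b i⟩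

/-- The coefficients of every form of `Ψ_b` are `(1)`. [cite: GreenTao2010, Example 1] -/
@[simp] theorem tupleShiftSystem_coeff (b : Fin m → ℤ) (i : Fin (m + 1)) :
    (tupleShiftSystem b i).coeff = ![1] := rfl

/-- The constant of the `i`-th form of `Ψ_b` is the `i`-th shift. [cite: GreenTao2010, Example 1] -/
@[simp] theorem tupleShiftSystem_const (b : Fin m → ℤ) (i : Fin (m + 1)) :
    (tupleShiftSystem b i).const = tupleShifts b i := rfl

/-- `ψ_i(n) = n + (tupleShifts b)_i`. [cite: GreenTao2010, Example 1] -/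
@[simp] theorem tupleShiftSystem_eval (b : Fin m → ℤ) (i : Fin (m + 1)) (n : Fin 1 → ℤ) :
    (tupleShiftSystem b i).eval n = n 0 + tupleShifts b i := by
  simp [tupleShiftSystem, AffLinForm.eval]

/-- The tree's shift pair `(n, n + h)` is the shifted tuple system of the one-entry tuple `(h)`.
[cite: GreenTao2010, Example 1] -/
theorem shiftPairSystem_eq_tupleShiftSystem (h : ℤ) :
    shiftPairSystem h = tupleShiftSystem (fun _ : Fin 1 => h) := by
  funext i
  fin_cases i
  · rfl
  · simp only [shiftPairSystem, tupleShiftSystem, Fin.mk_one, Matrix.cons_val_one,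
      Matrix.cons_val_zero]
    congr 1

/-- **Non-degeneracy.** If the shifts `(0, b₁, …, b_m)` are pairwise distinct, `Ψ_b` satisfies
Green–Tao's standing hypotheses: every form is non-constant, and `a (n + s_i) = c (n + s_j)` for all
`n` forces `a = c` (compare `n = 0, 1`) and then `a (s_i - s_j) = 0`, so `a = c = 0`. (Its complexity is
infinite: all linear parts coincide.) [cite: GreenTao2010, Def. 1.1 and Example 1] -/
theorem isNondegenerateSystem_tupleShiftSystem {b : Fin m → ℤ}
    (hb : Function.Injective (tupleShifts b)) : IsNondegenerateSystem (tupleShiftSystem b) := by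
  refine ⟨fun i h => ?_, fun i j hij a c hac => ?_⟩
  · have := congr_fun h 0
    simp at this
  · have h0 := hac fun _ => 0
    have h1 := hac fun _ => 1
    simp only [tupleShiftSystem_eval, zero_add, mul_add, mul_one] at h0 h1
    have hac' : a = c := by linarith
    subst hac'
    rcases mul_eq_mul_left_iff.mp h0 with h | h
    · exact absurd (hb h) hij
    · exact ⟨h, h⟩

/-- **Size.** If every shift has `|s_i| ≤ N` then `‖Ψ_b‖_N = (m + 1) + ∑_i |s_i| / N ≤ 2(m + 1)`
(Green–Tao's (1.1)). [cite: GreenTao2010, (1.1)] -/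
theorem affLinSize_tupleShiftSystem_le {b : Fin m → ℤ} {N : ℝ} (hN : 0 < N)
    (hb : ∀ i, |(tupleShifts b i : ℝ)| ≤ N) :
    affLinSize (tupleShiftSystem b) N ≤ (2 * (m + 1) : ℕ) := by
  unfold affLinSize
  have h1 : ∀ i : Fin (m + 1), ∑ j, |(((tupleShiftSystem b i).coeff j : ℤ) : ℝ)| = 1 := by
    intro i
    simp
  have h2 : ∀ i : Fin (m + 1), |(((tupleShiftSystem b i).const : ℤ) : ℝ) / N| ≤ 1 := by
    intro i
    rw [abs_div, abs_of_pos hN, div_le_one hN, tupleShiftSystem_const]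
    exact hb i
  calc ∑ i, ∑ j, |(((tupleShiftSystem b i).coeff j : ℤ) : ℝ)| +
        ∑ i, |(((tupleShiftSystem b i).const : ℤ) : ℝ) / N|
      ≤ ∑ _i : Fin (m + 1), (1 : ℝ) + ∑ _i : Fin (m + 1), (1 : ℝ) :=
        add_le_add (Finset.sum_le_sum fun i _ => (h1 i).le) (Finset.sum_le_sum fun i _ => h2 i)
    _ = (2 * (m + 1) : ℕ) := by
        simp only [Finset.sum_const, Finset.card_univ, Fintype.card_fin, nsmul_eq_mul, mul_one]
        push_cast
        ring

/-! ### The convex body: every member at most `N` -/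

/-- `max_j b_j⁺` (as a natural number; `0` for the empty tuple). [cite: Kawada1993, §1 p. 43] -/
def maxShift (b : Fin m → ℤ) : ℕ :=
  Finset.univ.sup fun j => (b j).toNat

/-- Each `b_j⁺` is at most `maxShift b`. [cite: Kawada1993, §1 p. 43] -/
theorem toNat_le_maxShift (b : Fin m → ℤ) (j : Fin m) : (b j).toNat ≤ maxShift b :=
  Finset.le_sup (f := fun j => (b j).toNat) (Finset.mem_univ j)

/-- If every `b_j ≤ N` then `maxShift b ≤ N`. [cite: Kawada1993, §1 p. 43] -/
theorem maxShift_le {b : Fin m → ℤ} {N : ℕ} (hb : ∀ j, b j ≤ N) : maxShift b ≤ N :=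
  Finset.sup_le fun j _ => by simpa using hb j

/-- The shifted box `[-(N - max_j b_j⁺), N - max_j b_j⁺] ⊆ ℝ`, i.e. `realBox 1 (N - maxShift b)`:
the part of the Green–Tao box `[-N, N]` on which every member `n + b_j` is `≤ N` (together with
`Λ = 0` on `ℤ_{≤ 0}` this realises Kawada's summation range `1 ≤ n + b_j ≤ N` for all `j`).
[cite: Kawada1993, §1 p. 43] [cite: GreenTao2010, §1] -/
def shiftedBox (b : Fin m → ℤ) (N : ℕ) : Set (Fin 1 → ℝ) :=
  realBox 1 ((N : ℝ) - maxShift b)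

/-- Green–Tao boxes are convex. [cite: GreenTao2010, §1] -/
theorem convex_realBox (d : ℕ) (R : ℝ) : Convex ℝ (realBox d R) :=
  convex_Icc _ _

/-- The shifted box is convex. [cite: GreenTao2010, §1] -/
theorem convex_shiftedBox (b : Fin m → ℤ) (N : ℕ) : Convex ℝ (shiftedBox b N) :=
  convex_realBox _ _

/-- The shifted box lies in the Green–Tao box `[-N, N]`. [cite: GreenTao2010, §1] -/
theorem shiftedBox_subset_realBox (b : Fin m → ℤ) (N : ℕ) : shiftedBox b N ⊆ realBox 1 N :=
  have h : (N : ℝ) - maxShift b ≤ N := sub_le_self _ (Nat.cast_nonneg _)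
  Set.Icc_subset_Icc (fun _ => neg_le_neg h) fun _ => h

/-! ### The named facts: Hardy–Littlewood tuples / pairs for almost all shift vectors -/

open Classical in
/-- **Prime `k`-tuples with von Mangoldt weights: the Hardy–Littlewood asymptotic holds for almost
all shift vectors** (a THEOREM: Balog 1990; Kawada 1993, Theorem 1 at `q = 1`), qualitative counting
form in the Green–Tao dictionary. For every `m ≥ 1` (`k = m + 1` members) and every `ε > 0` there is
`N₀` such that for all `N ≥ N₀`: among the shift vectors `b ∈ [1, N]^m` with pairwise distinct
entries, at most `ε N^m` have
`|∑_{n ∈ [-N,N] ∩ K_b} Λ(n) ∏_j Λ(n + b_j) - β_∞(K_b) ∏_p β_p(Ψ_b)| > ε N`, `K_b = shiftedBox b N`;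
in Kawada's notation (`a = (1, …, 1, 0)`) the three quantities are
`Ψ(N; b) = ∑_{1 ≤ n ≤ N - max b} Λ(n) ∏_j Λ(n + b_j)`, `|N(N; b)| = N - max_j b_j` and
`σ(b) = ∏_p (1 - ρ_b(p)/p)(1 - 1/p)^{-(m+1)}`. PRINT STATUS: proved — Kawada, Theorem 1 / (1.1)
(p. 44) with `Q = 1`: `∑_{b ∈ Z(x)} |Ψ(x; b) - σ(b)|N(x; b)|| ≪_A x^{m+1} (log x)^{-A}` ("Balog [1]
proved that the inequality (1.1) holds for the general case `k ≥ 2`"), whence the counting form by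
Markov's inequality. Kernel status: to be formalised (Parity ladder rung F-AVG; the case `m = 1` is
`hardyLittlewoodPairs_almostAllShifts`); meanwhile it is certified ON-PATH:
`hardyLittlewoodTuples_almostAllShifts_of_generalizedHardyLittlewood` (proved below) derives it from
`GeneralizedHardyLittlewood`, of whose binary case `d = 1` it is the shift average ("This essentially
amounts to increasing `d`", Green–Tao 2010 §1).
[cite: Kawada1993, Theorem 1 and (1.1), p. 44 (case Q = 1)] [cite: Balog1990]
[cite: GreenTao2010, §1 remark on Balog (arXiv p. 5)] -/
def hardyLittlewoodTuples_almostAllShifts : Prop :=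
  ∀ m : ℕ, 1 ≤ m → ∀ ε : ℝ, 0 < ε → ∃ N₀ : ℕ, ∀ N : ℕ, N₀ ≤ N →
    (#((Fintype.piFinset fun _ : Fin m => Icc (1 : ℤ) N).filter fun b =>
        Function.Injective b ∧
          ε * N < |vonMangoldtSum (tupleShiftSystem b) (shiftedBox b N) N -
            archFactor (tupleShiftSystem b) (shiftedBox b N) *
              singularProduct (tupleShiftSystem b)|) : ℝ) ≤ ε * (N : ℝ) ^ m

open Classical in
/-- **Prime pairs with von Mangoldt weights: the Hardy–Littlewood asymptotic holds for almost all
shifts** (a THEOREM: van der Corput 1937, Lavrik 1960, Mikawa 1991/1992, as reported in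
Matomäki–Radziwiłł–Tao 2019 §1.1: "[these results] show that (the prime-pair asymptotic) holds for
'most' `h` with `|h| ≤ H`"; Kawada 1993 Theorem 1 with `k = 2`, `Q = 1`), qualitative counting form
over the tree's `shiftPairSystem h = (n, n + h)` and the box `[-(N - h), N - h]`: for every `ε > 0` and
all large `N`, at most `ε N` of the shifts `1 ≤ h ≤ N` have
`|∑_{1 ≤ n ≤ N - h} Λ(n)Λ(n + h) - 𝔖(h)(N - h)| > ε N`, where `𝔖(h) = singularProduct (shiftPairSystem h)`
(`= 2C₂ ∏_{p ∣ h, p > 2} (p-1)/(p-2)` for even `h`, `0` for odd `h`). PRINT STATUS: proved (loc. cit.;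
Mikawa 1992 even with the level of distribution `x^{1/2}(log x)^{-B}` over moduli, whose term `q = 1`
is this shift average with saving `(log x)^{-A}`). Kernel status: to be formalised (rung F-AVG) — its
inputs in the tree are the major arcs
`Literature.NumberTheory.Sieve.primePairMajorArcs_logPow_of_siegelWalfisz` (uniform in `0 < |h| ≤ N`,
PROVED), Vinogradov's minor-arc bound
`Literature.NumberTheory.Sieve.Vinogradov.vinogradov_primeExpSumLog_bound` (PROVED) and Bessel's
inequality over the shifts; meanwhile it is certified ON-PATH by
`hardyLittlewoodPairs_almostAllShifts_of_generalizedHardyLittlewood` (proved below).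
[cite: MatomakiRadziwillTao2019, §1.1 p. 4 (arXiv)] [cite: Kawada1993, Theorem 1 and (1.1), p. 44 (k = 2, Q = 1)]
[cite: Mikawa1992] -/
def hardyLittlewoodPairs_almostAllShifts : Prop :=
  ∀ ε : ℝ, 0 < ε → ∃ N₀ : ℕ, ∀ N : ℕ, N₀ ≤ N →
    (#((Icc 1 N).filter fun h : ℕ =>
        ε * N < |vonMangoldtSum (shiftPairSystem h) (realBox 1 ((N : ℝ) - h)) N -
            archFactor (shiftPairSystem h) (realBox 1 ((N : ℝ) - h)) *
              singularProduct (shiftPairSystem h)|) : ℝ) ≤ ε * N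

/-! ### On-path certificates: both named facts follow from `GeneralizedHardyLittlewood` -/

/-- **Uniform form from the conjecture.** `GeneralizedHardyLittlewood` at `d = 1`, `t = m + 1`,
`L = 2(m + 1)` bounds the discrepancy of EVERY shifted tuple system with distinct shifts in
`[1, N]^m` by `ε N`, for all large `N`. [cite: GreenTao2010, Conj. 1.2 and Example 1] -/
theorem tupleShift_discrepancy_le_of_generalizedHardyLittlewood (hGHL : GeneralizedHardyLittlewood)
    (m : ℕ) {ε : ℝ} (hε : 0 < ε) :
    ∃ N₀ : ℕ, ∀ N : ℕ, N₀ ≤ N → ∀ b : Fin m → ℤ, (∀ j, 1 ≤ b j ∧ b j ≤ N) →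
      Function.Injective b →
        |vonMangoldtSum (tupleShiftSystem b) (shiftedBox b N) N -
            archFactor (tupleShiftSystem b) (shiftedBox b N) * singularProduct (tupleShiftSystem b)| ≤
          ε * N := by
  obtain ⟨N₀, hN₀⟩ := hGHL 1 (m + 1) (2 * (m + 1)) le_rfl (Nat.succ_pos m) ε hε
  refine ⟨max N₀ 1, fun N hN b hb hinj => ?_⟩
  have hN₀N : N₀ ≤ N := le_of_max_le_left hN
  have hN1 : (0 : ℝ) < N := by exact_mod_cast le_of_max_le_right hN
  have hshift : Function.Injective (tupleShifts b) :=
    (tupleShifts_injective_iff b).mpr ⟨fun j => by have := (hb j).1; omega, hinj⟩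
  have hsize : affLinSize (tupleShiftSystem b) N ≤ (2 * (m + 1) : ℕ) := by
    refine affLinSize_tupleShiftSystem_le hN1 fun i => ?_
    refine Fin.cases ?_ (fun j => ?_) i
    · simp [hN1.le]
    · rw [tupleShifts_succ, abs_le]
      have h1 := (hb j).1
      have h2 := (hb j).2
      constructor
      · have : (-(N : ℝ)) ≤ 1 := by linarith
        exact this.trans (by exact_mod_cast h1)
      · exact_mod_cast h2
  have key := hN₀ N hN₀N (tupleShiftSystem b) (isNondegenerateSystem_tupleShiftSystem hshift) hsize
    (shiftedBox b N) (convex_shiftedBox b N) (shiftedBox_subset_realBox b N)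
  simpa using key

/-- **On-path certificate (tuples).** `GeneralizedHardyLittlewood → hardyLittlewoodTuples_almostAllShifts`:
under the conjecture the exceptional set is empty for all large `N`.
[cite: GreenTao2010, Conj. 1.2] [cite: Kawada1993, Theorem 1] -/
theorem hardyLittlewoodTuples_almostAllShifts_of_generalizedHardyLittlewood
    (hGHL : GeneralizedHardyLittlewood) : hardyLittlewoodTuples_almostAllShifts := by
  classical
  intro m _hm ε hε
  obtain ⟨N₀, hN₀⟩ := tupleShift_discrepancy_le_of_generalizedHardyLittlewood hGHL m hε
  refine ⟨N₀, fun N hN => ?_⟩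
  rw [Finset.filter_eq_empty_iff.mpr, Finset.card_empty, Nat.cast_zero]
  · positivity
  · rintro b hb ⟨hinj, hlt⟩
    have hb' : ∀ j, 1 ≤ b j ∧ b j ≤ N := fun j =>
      Finset.mem_Icc.mp (Fintype.mem_piFinset.mp hb j)
    exact absurd (hN₀ N hN b hb' hinj) (not_le.mpr hlt)

/-- **On-path certificate (pairs).** `GeneralizedHardyLittlewood → hardyLittlewoodPairs_almostAllShifts`
(through `shiftPairSystem_eq_tupleShiftSystem` and the tuple certificate with `m = 1`).
[cite: GreenTao2010, Conj. 1.2 and Example 1] [cite: MatomakiRadziwillTao2019, §1.1 p. 4 (arXiv)] -/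
theorem hardyLittlewoodPairs_almostAllShifts_of_generalizedHardyLittlewood
    (hGHL : GeneralizedHardyLittlewood) : hardyLittlewoodPairs_almostAllShifts := by
  classical
  intro ε hε
  obtain ⟨N₀, hN₀⟩ := tupleShift_discrepancy_le_of_generalizedHardyLittlewood hGHL 1 hε
  refine ⟨N₀, fun N hN => ?_⟩
  rw [Finset.filter_eq_empty_iff.mpr, Finset.card_empty, Nat.cast_zero]
  · positivity
  · intro h hh hlt
    obtain ⟨h1, h2⟩ := Finset.mem_Icc.mp hh
    have hb : ∀ _j : Fin 1, (1 : ℤ) ≤ (h : ℤ) ∧ (h : ℤ) ≤ (N : ℤ) :=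
      fun _ => ⟨by exact_mod_cast h1, by exact_mod_cast h2⟩
    have hinj : Function.Injective (fun _ : Fin 1 => (h : ℤ)) :=
      fun i j _ => Subsingleton.elim i j
    have key := hN₀ N hN _ hb hinj
    have hbox : shiftedBox (fun _ : Fin 1 => (h : ℤ)) N = realBox 1 ((N : ℝ) - h) := by
      simp [shiftedBox, maxShift]
    rw [hbox, ← shiftPairSystem_eq_tupleShiftSystem] at key
    exact absurd key (not_le.mpr hlt)

end Literature.NumberTheory.Sieve

end
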